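import Literature.NumberTheory.ComplexMultiplication.CMTypeRankBlockConjugation
import HarnessLib

/-!
# Type-level block conjugations and stabiliser separation: two splitting criteria for the rank of a family of CM types
# that only look at the TYPES `Φ_i`, not at the pointwise action on the embeddings

Companion of `NumberTheory/ComplexMultiplication/CMTypeRankFamilies` and `CMTypeRankBlockConjugation` (abstract setting:
a group `G` acting slot by slot on `⊔_i E_i`, a commuting "complex conjugation" `ρ ∈ G`, CM types `Φ_i ⊆ E_i` for `ρ`,
the family type `Σ = sigmaType Φ`, Shimura's antisymmetric span `U(Σ) = antiSpan G Σ = span{u_g}`, `rank = dim U + 1`,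
the slot extensions `slotExt i : ℚ^{E_i} → ℚ^{⊔E}`).

`CMTypeRankBlockConjugation` splits the rank along a block `B = {i | p i}` given `σ ∈ G` acting AS `ρ` ON EVERY
EMBEDDING of the slots in `B` and TRIVIALLY ON EVERY EMBEDDING off `B`.  Since `U(Σ)` is the `ℚ[G]`-module generated by
the single vector `u_1 = Σ_i ext_i(u_1(Φ_i))` (Deligne I Ex. 3.7 (c): "`Y(G)` is the `Gal(ℚ̄/ℚ)`-module generated by `μ`"),
much less is needed:

§1 **Type-level block conjugation.**  It suffices that `σ` maps the TYPES of the block to their conjugates and stabilises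
the other TYPES: `σ⁻¹Φ_i = ρΦ_i` (`σy ∈ Φ_i ↔ ρy ∈ Φ_i`) for `i ∈ B` and `σ⁻¹Φ_i = Φ_i` (`σy ∈ Φ_i ↔ y ∈ Φ_i`) for `i ∉ B`
— then `u_{σg} = −u_g` on the block and `u_{σg} = u_g` off it, and the proof of `CMTypeRankBlockConjugation` goes through
verbatim with the partner `σg` in place of `gσ`:
* `map_antiSpan_sigmaType_eq_prod_of_typeConj` (`U(Σ) ≅ U(Σ|_B) × U(Σ|_{Bᶜ})`), `finrank_antiSpan_sigmaType_eq_add_of_typeConj`,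
  **`typeRank_sigmaType_add_one_eq_of_typeConj`** (`rank(Σ) + 1 = rank(Σ|_B) + rank(Σ|_{Bᶜ})`),
  **`typeRank_sigmaType_eq_iff_of_typeConj`** (`Σ` nondegenerate iff both blocks are); `typeConj_of_pointwise`,
  `typeConj_of_pointwise'` (the hypotheses of `CMTypeRankBlockConjugation` imply these).
The gain is real: for a primitive type `Φ` of a non-Galois field the elements of `Gal(ℚ̄/ℚ)` mapping `Φ` to `ρΦ` form the
coset `ρ · Gal(ℚ̄/K*)` of the stabiliser of `Φ` (`K*` the reflex field), not just `{ρ}·(pointwise stabiliser)`.  Example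
(Moonen–Zarhin, "Hodge groups of simple abelian surfaces of CM-type"; `Summits/…/QuarticCMTypePairNondegenerate`): for the
two CM-inequivalent types `Φ = {a, b}`, `Φ' = {a, b̄}` of a non-Galois quartic CM field the dihedral reflection
`(a b̄)(b ā)` maps `Φ` to `ρΦ` and fixes `Φ'` (it fixes NO embedding), so `rank(Φ, Φ') − 1 = (rank Φ − 1) + (rank Φ' − 1) = 4`.

§2 **Stabiliser separation at one slot.**  If `g ∈ G` stabilises every type `Φ_i`, `i ≠ i₁` (`g⁻¹Φ_i = Φ_i`), then
`u_{gh} − u_h` is supported on the slot `i₁` for every `h`, so the `G`-stable subspace `W = span{u_{gh}(Φ_{i₁}) − u_h(Φ_{i₁})}`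
of `U(Φ_{i₁})` satisfies `ext_{i₁}(W) ≤ U(Σ)`.  If `g` does NOT stabilise `Φ_{i₁}` then `W ≠ 0`, and if `U(Φ_{i₁})` has no
`G`-stable subspace other than `0` and itself ("`U(Φ_{i₁})` irreducible"), `ext_{i₁} U(Φ_{i₁}) ≤ U(Σ)`:
* **`map_slotExt_antiSpan_le_of_stabSep`**; for a two-slot family then also `ext_{i₀} U(Φ_{i₀}) ≤ U(Σ)` and
  **`typeRank_sigmaType_add_card_eq_of_stabSep_pair`**, **`typeRank_sigmaType_eq_iff_forall_of_stabSep_pair`**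
  (`rank(Φ₀, Φ₁) − 1 = (rank Φ₀ − 1) + (rank Φ₁ − 1)`; the pair is nondegenerate iff both members are).
This is the mechanism for the MIXED dihedral pair (a quartic CM field `K` and the other quartic CM class `M` of its Galois
closure, e.g. its reflex field): the reflection of `M` fixing an embedding `t₀` swaps the two members of a `K`-type
`{a, b}` — it stabilises `Φ = {a, b}` and moves every type of `M` (`Summits/…/DihedralReflexPairCMHodge`).

§0 records the bookkeeping common to all such criteria: **if `ext_i U(Φ_i) ≤ U(Σ)` for every `i` then
`rank(Σ) − 1 = Σ_i (rank(Φ_i) − 1)`** and `Σ` is nondegenerate iff every member is (`…_of_forall_map_le`; the proofs of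
`CMTypeRankFamilies` under slotwise independence and of `CMTypeRankCommonConstituent` under the pairwise criterion used
exactly this).

Everything is PROVED (finite-dimensional linear algebra over `ℚ`); theorems only; no definition, no named fact, no `sorry`.

## References

* [Deligne1982HodgeCycles] P. Deligne, *Hodge cycles on abelian varieties*, LNM 900 (1982), I Ex. 3.7 (c).
* [Gordon1999HodgeAVSurvey] B. B. Gordon, *A survey of the Hodge conjecture for abelian varieties*, §3 Theorem (Imai,
  Murty) with proof; 7.5–7.7.
* [MoonenZarhin1999LowDim] B. Moonen, Yu. Zarhin, *Hodge classes on abelian varieties of low dimension*, Math. Ann. 315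
  (1999) 711–733, "Hodge groups of simple abelian surfaces of CM-type".
-/

set_option autoImplicit false

noncomputable section

open scoped BigOperators

namespace Literature.NumberTheory.ComplexMultiplication

variable {G : Type*} [Group G] {I : Type*} {E : I → Type*} [∀ i, MulAction G (E i)]

/-! ### §0 Bookkeeping: `ext_i U(Φ_i) ≤ U(Σ)` for all `i` gives rank additivity -/

/-- `(a_i)_i ↦ ((i,s) ↦ a_i(s))` is injective on `∏_i U(Φ_i)`. [folklore] -/
private theorem injective_sigmaLift_pi (Φ : ∀ i, Set (E i)) :
    Function.Injective (sigmaLift ∘ₗ LinearMap.pi fun i => (antiSpan G (Φ i)).subtype ∘ₗ LinearMap.proj i) := by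
  intro a b hab
  funext i
  refine Subtype.ext (funext fun s => ?_)
  exact congrFun hab ⟨i, s⟩

section ForallMapLe

variable [DecidableEq I] [Fintype I]

/-- If every slot extension `ext_i U(Φ_i)` lies in `U(Σ)` then `⊕_i U(Φ_i) ⊆ U(Σ)` ("the kernel of `λ` is zero").
[cite: Gordon1999HodgeAVSurvey, §3 Theorem (proof)] -/
theorem range_le_antiSpan_sigmaType_of_forall_map_le {Φ : ∀ i, Set (E i)}
    (hall : ∀ i, (antiSpan G (Φ i)).map (slotExt i) ≤ antiSpan G (sigmaType Φ)) :
    LinearMap.range (sigmaLift ∘ₗ LinearMap.pi fun i => (antiSpan G (Φ i)).subtype ∘ₗ LinearMap.proj i) ≤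
      antiSpan G (sigmaType Φ) := by
  rintro _ ⟨a, rfl⟩
  change sigmaLift (fun i => (a i : E i → ℚ)) ∈ _
  rw [sigmaLift_eq_sum_slotExt]
  exact Submodule.sum_mem _ fun i _ => hall i ⟨(a i : E i → ℚ), (a i).2, rfl⟩

variable [∀ i, Fintype (E i)]

/-- **`dim U(Σ) = Σ_i dim U(Φ_i)` as soon as `ext_i U(Φ_i) ≤ U(Σ)` for all `i`** (`≤` always holds).
[cite: Gordon1999HodgeAVSurvey, §3 Theorem (1)] -/
theorem finrank_antiSpan_sigmaType_eq_of_forall_map_le {Φ : ∀ i, Set (E i)}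
    (hall : ∀ i, (antiSpan G (Φ i)).map (slotExt i) ≤ antiSpan G (sigmaType Φ)) :
    Module.finrank ℚ (antiSpan G (sigmaType Φ)) = ∑ i, Module.finrank ℚ (antiSpan G (Φ i)) := by
  refine le_antisymm (finrank_antiSpan_sigmaType_le Φ) ?_
  calc ∑ i, Module.finrank ℚ (antiSpan G (Φ i))
      = Module.finrank ℚ (∀ i, antiSpan G (Φ i)) := (Module.finrank_pi_fintype ℚ).symm
    _ = Module.finrank ℚ (LinearMap.range
          (sigmaLift ∘ₗ LinearMap.pi fun i => (antiSpan G (Φ i)).subtype ∘ₗ LinearMap.proj i)) :=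
        (LinearMap.finrank_range_of_inj (injective_sigmaLift_pi (G := G) Φ)).symm
    _ ≤ Module.finrank ℚ (antiSpan G (sigmaType Φ)) :=
        Submodule.finrank_mono (range_le_antiSpan_sigmaType_of_forall_map_le hall)

/-- **`rank(Σ) + |I| = Σ_i rank(Φ_i) + 1`, i.e. `rank(Σ) − 1 = Σ_i (rank(Φ_i) − 1)`, as soon as `ext_i U(Φ_i) ≤ U(Σ)`
for all `i`** (`Hg(A) = Hg(A_1) × ⋯ × Hg(A_r)`). [cite: Gordon1999HodgeAVSurvey, §3 Theorem (1)] -/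
theorem typeRank_sigmaType_add_card_eq_of_forall_map_le [Nonempty I] [∀ i, Nonempty (E i)] {ρ : G}
    {Φ : ∀ i, Set (E i)} (h : ∀ i, IsCMTypeWith ρ (Φ i))
    (hall : ∀ i, (antiSpan G (Φ i)).map (slotExt i) ≤ antiSpan G (sigmaType Φ)) :
    typeRank G (sigmaType Φ) + Fintype.card I = (∑ i, typeRank G (Φ i)) + 1 := by
  obtain ⟨i₀⟩ := ‹Nonempty I›
  haveI : Nonempty (Σ i, E i) := ⟨⟨i₀, Classical.arbitrary (E i₀)⟩⟩
  rw [(IsCMTypeWith.sigmaType h).typeRank_eq_finrank_antiSpan_add_one,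
    Finset.sum_congr rfl fun i _ => (h i).typeRank_eq_finrank_antiSpan_add_one, Finset.sum_add_distrib,
    Finset.sum_const, Finset.card_univ, smul_eq_mul, mul_one, finrank_antiSpan_sigmaType_eq_of_forall_map_le hall]
  omega

/-- **`Σ` is nondegenerate iff every member is, as soon as `ext_i U(Φ_i) ≤ U(Σ)` for all `i`** (rank additivity and
`rank(Φ_i) − 1 ≤ |E_i|/2` termwise). [cite: Gordon1999HodgeAVSurvey, §3 Theorem and 7.5] -/
theorem typeRank_sigmaType_eq_iff_forall_of_forall_map_le [Nonempty I] [∀ i, Nonempty (E i)] {ρ : G}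
    {Φ : ∀ i, Set (E i)} (h : ∀ i, IsCMTypeWith ρ (Φ i))
    (hall : ∀ i, (antiSpan G (Φ i)).map (slotExt i) ≤ antiSpan G (sigmaType Φ)) :
    typeRank G (sigmaType Φ) = Fintype.card (Σ i, E i) / 2 + 1 ↔
      ∀ i, typeRank G (Φ i) = Fintype.card (E i) / 2 + 1 := by
  have hsum := typeRank_sigmaType_add_card_eq_of_forall_map_le h hall
  have hle : ∀ i, typeRank G (Φ i) ≤ Fintype.card (E i) / 2 + 1 := fun i => (h i).typeRank_le
  have htot : ∑ j, (Fintype.card (E j) / 2 + 1) = (∑ j, Fintype.card (E j) / 2) + Fintype.card I := by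
    rw [Finset.sum_add_distrib, Finset.sum_const, Finset.card_univ, smul_eq_mul, mul_one]
  rw [card_sigma_div_two h]
  constructor
  · intro hS i
    by_contra hne
    have hlt : typeRank G (Φ i) < Fintype.card (E i) / 2 + 1 := lt_of_le_of_ne (hle i) hne
    have hsum_lt : ∑ j, typeRank G (Φ j) < ∑ j, (Fintype.card (E j) / 2 + 1) :=
      Finset.sum_lt_sum (fun j _ => hle j) ⟨i, Finset.mem_univ i, hlt⟩
    rw [htot] at hsum_lt
    omega
  · intro hall'
    have hsum_eq : ∑ j, typeRank G (Φ j) = ∑ j, (Fintype.card (E j) / 2 + 1) :=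
      Finset.sum_congr rfl fun j _ => hall' j
    rw [htot] at hsum_eq
    omega

end ForallMapLe

/-! ### §1 Type-level block conjugations -/

section TypeConj

variable {ρ : G} {Φ : ∀ i, Set (E i)} (p : I → Prop) {σ : G}

/-- A pointwise block conjugation (`σ = ρ` on every embedding of the block, as in `CMTypeRankBlockConjugation`) is a
type-level one. [cite: Gordon1999HodgeAVSurvey, §3 Theorem (proof)] -/
theorem typeConj_of_pointwise (hσ : ∀ i, p i → ∀ s : E i, σ • s = ρ • s) :
    ∀ i, p i → ∀ y : E i, σ • y ∈ Φ i ↔ ρ • y ∈ Φ i := fun i hi y => by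
  rw [hσ i hi y]

/-- A pointwise trivial action off the block (`σ = id` on every embedding, as in `CMTypeRankBlockConjugation`) stabilises
the types off the block. [cite: Gordon1999HodgeAVSurvey, §3 Theorem (proof)] -/
theorem typeConj_of_pointwise' (hσ' : ∀ i, ¬p i → ∀ s : E i, σ • s = s) :
    ∀ i, ¬p i → ∀ y : E i, σ • y ∈ Φ i ↔ y ∈ Φ i := fun i hi y => by
  rw [hσ' i hi y]

/-- On a slot of the block, `[σgy ∈ Φ_i] = 1 − [gy ∈ Φ_i]`: the translate by `σg` is the complement of the translate by
`g` there (`σ⁻¹Φ_i = ρΦ_i = Φ_iᶜ`). [cite: Deligne1982HodgeCycles, I Ex. 3.7 (c) (p. 26)] -/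
theorem translateInd_typeConj_mul_of_block (h : ∀ i, IsCMTypeWith ρ (Φ i))
    (hσ : ∀ i, p i → ∀ y : E i, σ • y ∈ Φ i ↔ ρ • y ∈ Φ i) {i : I} (hi : p i) (g : G) (y : E i) :
    translateInd (Φ i) (σ * g) y = 1 - translateInd (Φ i) g y := by
  rw [translateInd_mul]
  by_cases hm : g • y ∈ Φ i
  · rw [translateInd_of_mem hm, translateInd_of_not_mem
      (show σ • g • y ∉ Φ i from fun h' => (h i).mem_iff _ |>.1 hm ((hσ i hi _).1 h'))]
    norm_num
  · rw [translateInd_of_not_mem hm, translateInd_of_mem ((hσ i hi _).2 (((h i).rho_smul_mem_iff _).2 hm))]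
    norm_num

/-- Off the block, `[σgy ∈ Φ_i] = [gy ∈ Φ_i]` (`σ⁻¹Φ_i = Φ_i`). [cite: Deligne1982HodgeCycles, I Ex. 3.7 (c) (p. 26)] -/
theorem translateInd_typeConj_mul_of_not_block (hσ' : ∀ i, ¬p i → ∀ y : E i, σ • y ∈ Φ i ↔ y ∈ Φ i) {i : I}
    (hi : ¬p i) (g : G) (y : E i) : translateInd (Φ i) (σ * g) y = translateInd (Φ i) g y := by
  rw [translateInd_mul]
  by_cases hm : g • y ∈ Φ i
  · rw [translateInd_of_mem hm, translateInd_of_mem ((hσ' i hi _).2 hm)]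
  · rw [translateInd_of_not_mem hm, translateInd_of_not_mem (fun h' => hm ((hσ' i hi _).1 h'))]

/-- `u_{σg} = −u_g` on the slots of the block. [cite: Gordon1999HodgeAVSurvey, §3 Theorem (proof)] -/
theorem antiVec_sigmaType_typeConj_mul_apply_of_block (h : ∀ i, IsCMTypeWith ρ (Φ i))
    (hσ : ∀ i, p i → ∀ y : E i, σ • y ∈ Φ i ↔ ρ • y ∈ Φ i) (g : G) (x : Σ i, E i) (hx : p x.1) :
    antiVec (sigmaType Φ) (σ * g) x = -antiVec (sigmaType Φ) g x := by
  rw [antiVec_sigmaType, antiVec_sigmaType]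
  simp only [antiVec, translateInd_typeConj_mul_of_block p h hσ hx]
  ring

/-- `u_{σg} = u_g` off the block. [cite: Gordon1999HodgeAVSurvey, §3 Theorem (proof)] -/
theorem antiVec_sigmaType_typeConj_mul_apply_of_not_block (hσ' : ∀ i, ¬p i → ∀ y : E i, σ • y ∈ Φ i ↔ y ∈ Φ i)
    (g : G) (x : Σ i, E i) (hx : ¬p x.1) :
    antiVec (sigmaType Φ) (σ * g) x = antiVec (sigmaType Φ) g x := by
  rw [antiVec_sigmaType, antiVec_sigmaType]
  simp only [antiVec, translateInd_typeConj_mul_of_not_block p hσ' hx]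

/-- `u_g − u_{σg}` restricted to the block is `2 u_g(Σ|_B)`. [cite: Gordon1999HodgeAVSurvey, §3 Theorem (proof)] -/
theorem funLeft_antiVec_sub_antiVec_typeConj_mul_of_block (h : ∀ i, IsCMTypeWith ρ (Φ i))
    (hσ : ∀ i, p i → ∀ y : E i, σ • y ∈ Φ i ↔ ρ • y ∈ Φ i) (g : G) :
    LinearMap.funLeft ℚ ℚ (fun x : (Σ i : {i // p i}, E i.1) => (⟨x.1.1, x.2⟩ : Σ i, E i))
        (antiVec (sigmaType Φ) g - antiVec (sigmaType Φ) (σ * g)) =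
      (2 : ℚ) • antiVec (sigmaType fun i : {i // p i} => Φ i.1) g := by
  rw [map_sub, funLeft_antiVec_sigmaType]
  funext x
  rw [Pi.sub_apply, LinearMap.funLeft_apply, antiVec_sigmaType_typeConj_mul_apply_of_block p h hσ g _ x.1.2,
    Pi.smul_apply, smul_eq_mul, ← funLeft_antiVec_sigmaType p Φ g, LinearMap.funLeft_apply]
  ring

/-- `u_g − u_{σg}` restricted OFF the block vanishes. [cite: Gordon1999HodgeAVSurvey, §3 Theorem (proof)] -/
theorem funLeft_antiVec_sub_antiVec_typeConj_mul_of_not_block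
    (hσ' : ∀ i, ¬p i → ∀ y : E i, σ • y ∈ Φ i ↔ y ∈ Φ i) (g : G) :
    LinearMap.funLeft ℚ ℚ (fun x : (Σ i : {i // ¬p i}, E i.1) => (⟨x.1.1, x.2⟩ : Σ i, E i))
        (antiVec (sigmaType Φ) g - antiVec (sigmaType Φ) (σ * g)) = 0 := by
  funext x
  rw [LinearMap.funLeft_apply, Pi.sub_apply, antiVec_sigmaType_typeConj_mul_apply_of_not_block p hσ' g _ x.1.2,
    sub_self, Pi.zero_apply]

/-- `u_g + u_{σg}` restricted to the block vanishes. [cite: Gordon1999HodgeAVSurvey, §3 Theorem (proof)] -/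
theorem funLeft_antiVec_add_antiVec_typeConj_mul_of_block (h : ∀ i, IsCMTypeWith ρ (Φ i))
    (hσ : ∀ i, p i → ∀ y : E i, σ • y ∈ Φ i ↔ ρ • y ∈ Φ i) (g : G) :
    LinearMap.funLeft ℚ ℚ (fun x : (Σ i : {i // p i}, E i.1) => (⟨x.1.1, x.2⟩ : Σ i, E i))
        (antiVec (sigmaType Φ) g + antiVec (sigmaType Φ) (σ * g)) = 0 := by
  funext x
  rw [LinearMap.funLeft_apply, Pi.add_apply, antiVec_sigmaType_typeConj_mul_apply_of_block p h hσ g _ x.1.2,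
    add_neg_cancel, Pi.zero_apply]

/-- `u_g + u_{σg}` restricted OFF the block is `2 u_g(Σ|_{Bᶜ})`. [cite: Gordon1999HodgeAVSurvey, §3 Theorem (proof)] -/
theorem funLeft_antiVec_add_antiVec_typeConj_mul_of_not_block
    (hσ' : ∀ i, ¬p i → ∀ y : E i, σ • y ∈ Φ i ↔ y ∈ Φ i) (g : G) :
    LinearMap.funLeft ℚ ℚ (fun x : (Σ i : {i // ¬p i}, E i.1) => (⟨x.1.1, x.2⟩ : Σ i, E i))
        (antiVec (sigmaType Φ) g + antiVec (sigmaType Φ) (σ * g)) =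
      (2 : ℚ) • antiVec (sigmaType fun i : {i // ¬p i} => Φ i.1) g := by
  rw [map_add, funLeft_antiVec_sigmaType]
  funext x
  rw [Pi.add_apply, LinearMap.funLeft_apply, antiVec_sigmaType_typeConj_mul_apply_of_not_block p hσ' g _ x.1.2,
    Pi.smul_apply, smul_eq_mul, ← funLeft_antiVec_sigmaType (fun i => ¬p i) Φ g, LinearMap.funLeft_apply]
  ring

/-- Under a type-level block conjugation the pair of restrictions of `u_g − u_{σg}` is `(2u_g(Σ|_B), 0)`.
[cite: Gordon1999HodgeAVSurvey, §3 Theorem (proof)] -/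
theorem prod_funLeft_antiVec_sub_antiVec_typeConj_mul (h : ∀ i, IsCMTypeWith ρ (Φ i))
    (hσ : ∀ i, p i → ∀ y : E i, σ • y ∈ Φ i ↔ ρ • y ∈ Φ i)
    (hσ' : ∀ i, ¬p i → ∀ y : E i, σ • y ∈ Φ i ↔ y ∈ Φ i) (g : G) :
    ((LinearMap.funLeft ℚ ℚ (fun x : (Σ i : {i // p i}, E i.1) => (⟨x.1.1, x.2⟩ : Σ i, E i))).prod
        (LinearMap.funLeft ℚ ℚ (fun x : (Σ i : {i // ¬p i}, E i.1) => (⟨x.1.1, x.2⟩ : Σ i, E i))))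
        (antiVec (sigmaType Φ) g - antiVec (sigmaType Φ) (σ * g)) =
      ((2 : ℚ) • antiVec (sigmaType fun i : {i // p i} => Φ i.1) g, 0) :=
  Prod.ext (funLeft_antiVec_sub_antiVec_typeConj_mul_of_block p h hσ g)
    (funLeft_antiVec_sub_antiVec_typeConj_mul_of_not_block p hσ' g)

/-- Under a type-level block conjugation the pair of restrictions of `u_g + u_{σg}` is `(0, 2u_g(Σ|_{Bᶜ}))`.
[cite: Gordon1999HodgeAVSurvey, §3 Theorem (proof)] -/
theorem prod_funLeft_antiVec_add_antiVec_typeConj_mul (h : ∀ i, IsCMTypeWith ρ (Φ i))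
    (hσ : ∀ i, p i → ∀ y : E i, σ • y ∈ Φ i ↔ ρ • y ∈ Φ i)
    (hσ' : ∀ i, ¬p i → ∀ y : E i, σ • y ∈ Φ i ↔ y ∈ Φ i) (g : G) :
    ((LinearMap.funLeft ℚ ℚ (fun x : (Σ i : {i // p i}, E i.1) => (⟨x.1.1, x.2⟩ : Σ i, E i))).prod
        (LinearMap.funLeft ℚ ℚ (fun x : (Σ i : {i // ¬p i}, E i.1) => (⟨x.1.1, x.2⟩ : Σ i, E i))))
        (antiVec (sigmaType Φ) g + antiVec (sigmaType Φ) (σ * g)) =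
      (0, (2 : ℚ) • antiVec (sigmaType fun i : {i // ¬p i} => Φ i.1) g) :=
  Prod.ext (funLeft_antiVec_add_antiVec_typeConj_mul_of_block p h hσ g)
    (funLeft_antiVec_add_antiVec_typeConj_mul_of_not_block p hσ' g)

/-- **Under a type-level block conjugation the pair of restrictions maps `U(Σ)` ONTO `U(Σ|_B) × U(Σ|_{Bᶜ})`**: the image
contains `(u_g(Σ|_B), 0) = ½(u_g − u_{σg})|` and `(0, u_g(Σ|_{Bᶜ})) = ½(u_g + u_{σg})|`.
[cite: Gordon1999HodgeAVSurvey, §3 Theorem (proof)] -/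
theorem map_antiSpan_sigmaType_eq_prod_of_typeConj (h : ∀ i, IsCMTypeWith ρ (Φ i))
    (hσ : ∀ i, p i → ∀ y : E i, σ • y ∈ Φ i ↔ ρ • y ∈ Φ i)
    (hσ' : ∀ i, ¬p i → ∀ y : E i, σ • y ∈ Φ i ↔ y ∈ Φ i) :
    (antiSpan G (sigmaType Φ)).map
        ((LinearMap.funLeft ℚ ℚ (fun x : (Σ i : {i // p i}, E i.1) => (⟨x.1.1, x.2⟩ : Σ i, E i))).prod
          (LinearMap.funLeft ℚ ℚ (fun x : (Σ i : {i // ¬p i}, E i.1) => (⟨x.1.1, x.2⟩ : Σ i, E i)))) =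
      (antiSpan G (sigmaType fun i : {i // p i} => Φ i.1)).prod
        (antiSpan G (sigmaType fun i : {i // ¬p i} => Φ i.1)) := by
  apply le_antisymm
  · rw [Submodule.map_le_iff_le_comap, antiSpan, Submodule.span_le]
    rintro _ ⟨g, rfl⟩
    rw [SetLike.mem_coe, Submodule.mem_comap, prod_funLeft_antiVec_sigmaType, Submodule.mem_prod]
    exact ⟨Submodule.subset_span ⟨g, rfl⟩, Submodule.subset_span ⟨g, rfl⟩⟩
  · rw [Submodule.prod_le_iff]
    constructor
    · rw [antiSpan, Submodule.map_span_le]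
      rintro _ ⟨g, rfl⟩
      refine ⟨(1 / 2 : ℚ) • (antiVec (sigmaType Φ) g - antiVec (sigmaType Φ) (σ * g)),
        Submodule.smul_mem _ _ (Submodule.sub_mem _ (Submodule.subset_span ⟨g, rfl⟩)
          (Submodule.subset_span ⟨σ * g, rfl⟩)), ?_⟩
      rw [map_smul, prod_funLeft_antiVec_sub_antiVec_typeConj_mul p h hσ hσ', LinearMap.inl_apply, Prod.smul_mk,
        smul_zero, smul_smul]
      norm_num
    · rw [antiSpan, Submodule.map_span_le]
      rintro _ ⟨g, rfl⟩
      refine ⟨(1 / 2 : ℚ) • (antiVec (sigmaType Φ) g + antiVec (sigmaType Φ) (σ * g)),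
        Submodule.smul_mem _ _ (Submodule.add_mem _ (Submodule.subset_span ⟨g, rfl⟩)
          (Submodule.subset_span ⟨σ * g, rfl⟩)), ?_⟩
      rw [map_smul, prod_funLeft_antiVec_add_antiVec_typeConj_mul p h hσ hσ', LinearMap.inr_apply, Prod.smul_mk,
        smul_zero, smul_smul]
      norm_num

variable [Fintype I] [∀ i, Fintype (E i)]

/-- **`dim U(Σ) = dim U(Σ|_B) + dim U(Σ|_{Bᶜ})` under a type-level block conjugation.**
[cite: Gordon1999HodgeAVSurvey, §3 Theorem (1)] -/
theorem finrank_antiSpan_sigmaType_eq_add_of_typeConj (h : ∀ i, IsCMTypeWith ρ (Φ i))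
    (hσ : ∀ i, p i → ∀ y : E i, σ • y ∈ Φ i ↔ ρ • y ∈ Φ i)
    (hσ' : ∀ i, ¬p i → ∀ y : E i, σ • y ∈ Φ i ↔ y ∈ Φ i) :
    Module.finrank ℚ (antiSpan G (sigmaType Φ)) =
      Module.finrank ℚ (antiSpan G (sigmaType fun i : {i // p i} => Φ i.1)) +
        Module.finrank ℚ (antiSpan G (sigmaType fun i : {i // ¬p i} => Φ i.1)) := by
  classical
  rw [(Submodule.equivMapOfInjective _ (injective_funLeft_prod_funLeft (E := E) p) (antiSpan G (sigmaType Φ))).finrank_eq,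
    map_antiSpan_sigmaType_eq_prod_of_typeConj p h hσ hσ']
  set P := antiSpan G (sigmaType fun i : {i // p i} => Φ i.1)
  set Q := antiSpan G (sigmaType fun i : {i // ¬p i} => Φ i.1)
  let e : (P.prod Q) ≃ₗ[ℚ] (P × Q) :=
    { toFun := fun x => (⟨x.1.1, (Submodule.mem_prod.1 x.2).1⟩, ⟨x.1.2, (Submodule.mem_prod.1 x.2).2⟩)
      map_add' := fun _ _ => rfl
      map_smul' := fun _ _ => rfl
      invFun := fun y => ⟨(y.1, y.2), Submodule.mem_prod.2 ⟨y.1.2, y.2.2⟩⟩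
      left_inv := fun _ => rfl
      right_inv := fun _ => rfl }
  rw [e.finrank_eq, Module.finrank_prod]

/-- `|⊔_i E_i| = |⊔_{i∈B} E_i| + |⊔_{i∉B} E_i|`. [folklore] -/
private theorem card_sigma_eq_card_sigma_subtype_add' [DecidablePred p] :
    Fintype.card (Σ i, E i) = Fintype.card (Σ i : {i // p i}, E i.1) + Fintype.card (Σ i : {i // ¬p i}, E i.1) := by
  rw [Fintype.card_sigma, Fintype.card_sigma, Fintype.card_sigma]
  exact (Fintype.sum_subtype_add_sum_subtype p fun i => Fintype.card (E i)).symm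

variable [∀ i, Nonempty (E i)]

/-- **`rank(Σ) + 1 = rank(Σ|_B) + rank(Σ|_{Bᶜ})` under a TYPE-LEVEL block conjugation** (`σ⁻¹Φ_i = ρΦ_i` on `B`,
`σ⁻¹Φ_i = Φ_i` off `B`; both blocks nonempty): `Hg(A_B × A_{Bᶜ}) = Hg(A_B) × Hg(A_{Bᶜ})`.
[cite: Gordon1999HodgeAVSurvey, §3 Theorem (1)] -/
theorem typeRank_sigmaType_add_one_eq_of_typeConj (h : ∀ i, IsCMTypeWith ρ (Φ i))
    (hσ : ∀ i, p i → ∀ y : E i, σ • y ∈ Φ i ↔ ρ • y ∈ Φ i)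
    (hσ' : ∀ i, ¬p i → ∀ y : E i, σ • y ∈ Φ i ↔ y ∈ Φ i) (hp : ∃ i, p i) (hnp : ∃ i, ¬p i) :
    typeRank G (sigmaType Φ) + 1 =
      typeRank G (sigmaType fun i : {i // p i} => Φ i.1) + typeRank G (sigmaType fun i : {i // ¬p i} => Φ i.1) := by
  classical
  obtain ⟨i₀, hi₀⟩ := hp
  obtain ⟨i₁, hi₁⟩ := hnp
  haveI : Nonempty (Σ i, E i) := ⟨⟨i₀, Classical.arbitrary (E i₀)⟩⟩
  haveI : Nonempty (Σ i : {i // p i}, E i.1) := ⟨⟨⟨i₀, hi₀⟩, Classical.arbitrary (E i₀)⟩⟩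
  haveI : Nonempty (Σ i : {i // ¬p i}, E i.1) := ⟨⟨⟨i₁, hi₁⟩, Classical.arbitrary (E i₁)⟩⟩
  rw [(IsCMTypeWith.sigmaType h).typeRank_eq_finrank_antiSpan_add_one,
    (IsCMTypeWith.sigmaType fun i : {i // p i} => h i.1).typeRank_eq_finrank_antiSpan_add_one,
    (IsCMTypeWith.sigmaType fun i : {i // ¬p i} => h i.1).typeRank_eq_finrank_antiSpan_add_one,
    finrank_antiSpan_sigmaType_eq_add_of_typeConj p h hσ hσ']
  ring

/-- **Splitting of nondegeneracy under a type-level block conjugation**: `Σ` is nondegenerate iff both `Σ|_B` and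
`Σ|_{Bᶜ}` are. [cite: Gordon1999HodgeAVSurvey, §3 Theorem and 7.5] -/
theorem typeRank_sigmaType_eq_iff_of_typeConj [DecidablePred p] (h : ∀ i, IsCMTypeWith ρ (Φ i))
    (hσ : ∀ i, p i → ∀ y : E i, σ • y ∈ Φ i ↔ ρ • y ∈ Φ i)
    (hσ' : ∀ i, ¬p i → ∀ y : E i, σ • y ∈ Φ i ↔ y ∈ Φ i) (hp : ∃ i, p i) (hnp : ∃ i, ¬p i) :
    typeRank G (sigmaType Φ) = Fintype.card (Σ i, E i) / 2 + 1 ↔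
      typeRank G (sigmaType fun i : {i // p i} => Φ i.1) = Fintype.card (Σ i : {i // p i}, E i.1) / 2 + 1 ∧
        typeRank G (sigmaType fun i : {i // ¬p i} => Φ i.1) = Fintype.card (Σ i : {i // ¬p i}, E i.1) / 2 + 1 := by
  have hsum := typeRank_sigmaType_add_one_eq_of_typeConj p h hσ hσ' hp hnp
  obtain ⟨i₀, hi₀⟩ := hp
  obtain ⟨i₁, hi₁⟩ := hnp
  haveI : Nonempty (Σ i : {i // p i}, E i.1) := ⟨⟨⟨i₀, hi₀⟩, Classical.arbitrary (E i₀)⟩⟩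
  haveI : Nonempty (Σ i : {i // ¬p i}, E i.1) := ⟨⟨⟨i₁, hi₁⟩, Classical.arbitrary (E i₁)⟩⟩
  have hP := IsCMTypeWith.sigmaType fun i : {i // p i} => h i.1
  have hQ := IsCMTypeWith.sigmaType fun i : {i // ¬p i} => h i.1
  have hleP := hP.typeRank_le
  have hleQ := hQ.typeRank_le
  obtain ⟨a, ha⟩ := hP.two_dvd_card
  obtain ⟨b, hb⟩ := hQ.two_dvd_card
  rw [card_sigma_eq_card_sigma_subtype_add' (E := E) p, ha, hb]
  rw [ha] at hleP
  rw [hb] at hleQ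
  have e1 : (2 * a + 2 * b) / 2 = a + b := by omega
  have e2 : 2 * a / 2 = a := by omega
  have e3 : 2 * b / 2 = b := by omega
  rw [e1, e2, e3]
  rw [e2] at hleP
  rw [e3] at hleQ
  constructor
  · intro hS
    constructor <;> omega
  · rintro ⟨h1, h2⟩
    omega

end TypeConj

/-! ### §2 Stabiliser separation at one slot -/

section StabSep

variable [DecidableEq I] {ρ : G} {Φ : ∀ i, Set (E i)} (i₁ : I) {g : G}

/-- `u_h(k y) = u_{hk}(y)`: precomposition with `k` permutes the vectors `u_h`. [cite: Deligne1982HodgeCycles, I Ex. 3.7 (c) (p. 26)] -/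
theorem antiVec_apply_smul {X : Type*} [MulAction G X] (Ψ : Set X) (h k : G) (y : X) :
    antiVec Ψ h (k • y) = antiVec Ψ (h * k) y := by
  simp only [antiVec, translateInd_mul]

/-- If `g` stabilises every type `Φ_i`, `i ≠ i₁` (`g⁻¹Φ_i = Φ_i`), then `u_{gh} − u_h` is the extension by zero from the
slot `i₁` of `u_{gh}(Φ_{i₁}) − u_h(Φ_{i₁})`, for every `h`. [cite: Gordon1999HodgeAVSurvey, §3 Theorem (proof)] -/
theorem antiVec_mul_sub_antiVec_eq_slotExt (hg0 : ∀ i, i ≠ i₁ → ∀ y : E i, g • y ∈ Φ i ↔ y ∈ Φ i) (h : G) :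
    antiVec (sigmaType Φ) (g * h) - antiVec (sigmaType Φ) h =
      slotExt i₁ (antiVec (Φ i₁) (g * h) - antiVec (Φ i₁) h) := by
  funext x
  obtain ⟨j, y⟩ := x
  rw [Pi.sub_apply, antiVec_sigmaType, antiVec_sigmaType]
  by_cases hji : j = i₁
  · subst hji
    rw [slotExt_apply_same, Pi.sub_apply]
  · rw [slotExt_apply_of_ne hji]
    have h1 : translateInd (Φ j) (g * h) y = translateInd (Φ j) h y := by
      rw [translateInd_mul]
      by_cases hm : h • y ∈ Φ j
      · rw [translateInd_of_mem hm, translateInd_of_mem ((hg0 j hji _).2 hm)]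
      · rw [translateInd_of_not_mem hm, translateInd_of_not_mem (fun h' => hm ((hg0 j hji _).1 h'))]
    simp only [antiVec, h1, sub_self]

/-- **Stabiliser separation.**  Let `g ∈ G` stabilise every type `Φ_i`, `i ≠ i₁`, but NOT `Φ_{i₁}`, and suppose `U(Φ_{i₁})`
has no `G`-stable subspace other than `0` and itself.  Then `ext_{i₁} U(Φ_{i₁}) ≤ U(Σ)`: the span of the
`u_{gh}(Φ_{i₁}) − u_h(Φ_{i₁})`, `h ∈ G`, is `G`-stable, non-zero (`h = 1`), hence all of `U(Φ_{i₁})`, and its extension by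
zero lies in `U(Σ)` ("`σm + m = (2m_1, 0, …, 0)` must be [in `X(Hg(A))`] as well", with `g − 1` in place of `σ + 1`).
[cite: Gordon1999HodgeAVSurvey, §3 Theorem (proof)] -/
theorem map_slotExt_antiSpan_le_of_stabSep (hg0 : ∀ i, i ≠ i₁ → ∀ y : E i, g • y ∈ Φ i ↔ y ∈ Φ i)
    (hg1 : ∃ y : E i₁, ¬(g • y ∈ Φ i₁ ↔ y ∈ Φ i₁))
    (hirr : ∀ W : Submodule ℚ (E i₁ → ℚ), W ≤ antiSpan G (Φ i₁) → W ≠ ⊥ →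
      (∀ (k : G) (f : E i₁ → ℚ), f ∈ W → (fun y => f (k • y)) ∈ W) → W = antiSpan G (Φ i₁)) :
    (antiSpan G (Φ i₁)).map (slotExt i₁) ≤ antiSpan G (sigmaType Φ) := by
  set W : Submodule ℚ (E i₁ → ℚ) :=
    Submodule.span ℚ (Set.range fun h : G => antiVec (Φ i₁) (g * h) - antiVec (Φ i₁) h) with hW
  -- `W ≤ U(Φ_{i₁})`
  have hWle : W ≤ antiSpan G (Φ i₁) := by
    rw [hW, Submodule.span_le]
    rintro _ ⟨h, rfl⟩
    exact Submodule.sub_mem _ (Submodule.subset_span ⟨g * h, rfl⟩) (Submodule.subset_span ⟨h, rfl⟩)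
  -- `W ≠ 0`
  have hWne : W ≠ ⊥ := by
    obtain ⟨y, hy⟩ := hg1
    intro hbot
    have hmem : antiVec (Φ i₁) (g * 1) - antiVec (Φ i₁) (1 : G) ∈ W := Submodule.subset_span ⟨(1 : G), rfl⟩
    rw [hbot, Submodule.mem_bot] at hmem
    have hy' := congrFun hmem y
    rw [Pi.sub_apply, Pi.zero_apply, mul_one] at hy'
    simp only [antiVec] at hy'
    by_cases hm : g • y ∈ Φ i₁ <;> by_cases hm' : y ∈ Φ i₁
    · exact hy ⟨fun _ => hm', fun _ => hm⟩
    · rw [translateInd_of_mem hm, translateInd_of_not_mem (by rwa [one_smul])] at hy'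
      norm_num at hy'
    · rw [translateInd_of_not_mem hm, translateInd_of_mem (by rwa [one_smul])] at hy'
      norm_num at hy'
    · exact hy ⟨fun h' => absurd h' hm, fun h' => absurd h' hm'⟩
  -- `W` is `G`-stable
  have hWst : ∀ (k : G) (f : E i₁ → ℚ), f ∈ W → (fun y => f (k • y)) ∈ W := by
    intro k f hf
    have : (fun y => f (k • y)) = LinearMap.funLeft ℚ ℚ (fun y : E i₁ => k • y) f := rfl
    rw [this]
    refine (Submodule.map_span_le _ _ _ |>.2 ?_) ⟨f, hf, rfl⟩
    rintro _ ⟨h, rfl⟩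
    refine Submodule.subset_span ⟨h * k, ?_⟩
    funext y
    simp only [LinearMap.funLeft_apply, Pi.sub_apply, antiVec_apply_smul, mul_assoc]
  have hWeq : W = antiSpan G (Φ i₁) := hirr W hWle hWne hWst
  -- extensions by zero of `W` lie in `U(Σ)`
  rw [← hWeq, hW, Submodule.map_span_le]
  rintro _ ⟨h, rfl⟩
  rw [← antiVec_mul_sub_antiVec_eq_slotExt i₁ hg0 h]
  exact Submodule.sub_mem _ (Submodule.subset_span ⟨g * h, rfl⟩) (Submodule.subset_span ⟨h, rfl⟩)

variable [Fintype I]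

/-- **Two slots.**  For a two-slot family `{i₀, i₁}`, stabiliser separation at `i₁` also puts `ext_{i₀} U(Φ_{i₀})` inside
`U(Σ)` (`ext_{i₀} u_h(Φ_{i₀}) = u_h − ext_{i₁} u_h(Φ_{i₁})`), so EVERY slot extension lies in `U(Σ)`.
[cite: Gordon1999HodgeAVSurvey, §3 Theorem (proof)] -/
theorem forall_map_slotExt_le_of_stabSep_pair {i₀ : I} (hI : ∀ j, j = i₀ ∨ j = i₁) (h01 : i₀ ≠ i₁)
    (hg0 : ∀ i, i ≠ i₁ → ∀ y : E i, g • y ∈ Φ i ↔ y ∈ Φ i)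
    (hg1 : ∃ y : E i₁, ¬(g • y ∈ Φ i₁ ↔ y ∈ Φ i₁))
    (hirr : ∀ W : Submodule ℚ (E i₁ → ℚ), W ≤ antiSpan G (Φ i₁) → W ≠ ⊥ →
      (∀ (k : G) (f : E i₁ → ℚ), f ∈ W → (fun y => f (k • y)) ∈ W) → W = antiSpan G (Φ i₁)) :
    ∀ i, (antiSpan G (Φ i)).map (slotExt i) ≤ antiSpan G (sigmaType Φ) := by
  have h1 := map_slotExt_antiSpan_le_of_stabSep i₁ hg0 hg1 hirr
  have h0 : (antiSpan G (Φ i₀)).map (slotExt i₀) ≤ antiSpan G (sigmaType Φ) := by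
    rw [antiSpan, Submodule.map_span_le]
    rintro _ ⟨h, rfl⟩
    have hsum : antiVec (sigmaType Φ) h = slotExt i₀ (antiVec (Φ i₀) h) + slotExt i₁ (antiVec (Φ i₁) h) := by
      rw [antiVec_sigmaType_eq_sigmaLift, sigmaLift_eq_sum_slotExt]
      exact Fintype.sum_eq_add i₀ i₁ h01 fun j hj => by
        rcases hI j with rfl | rfl
        · exact absurd rfl hj.1
        · exact absurd rfl hj.2
    have heq : slotExt i₀ (antiVec (Φ i₀) h) = antiVec (sigmaType Φ) h - slotExt i₁ (antiVec (Φ i₁) h) := by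
      rw [hsum, add_sub_cancel_right]
    rw [heq]
    exact Submodule.sub_mem _ (Submodule.subset_span ⟨h, rfl⟩) (h1 ⟨antiVec (Φ i₁) h, Submodule.subset_span ⟨h, rfl⟩, rfl⟩)
  intro i
  rcases hI i with rfl | rfl
  · exact h0
  · exact h1

variable [∀ i, Fintype (E i)] [∀ i, Nonempty (E i)]

/-- **Rank additivity for a pair under stabiliser separation**: `rank(Φ₀, Φ₁) + 2 = rank(Φ₀) + rank(Φ₁) + 1`
(`Hg(A₀ × A₁) = Hg(A₀) × Hg(A₁)`). [cite: Gordon1999HodgeAVSurvey, §3 Theorem (1)] -/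
theorem typeRank_sigmaType_add_card_eq_of_stabSep_pair (h : ∀ i, IsCMTypeWith ρ (Φ i)) {i₀ : I}
    (hI : ∀ j, j = i₀ ∨ j = i₁) (h01 : i₀ ≠ i₁) (hg0 : ∀ i, i ≠ i₁ → ∀ y : E i, g • y ∈ Φ i ↔ y ∈ Φ i)
    (hg1 : ∃ y : E i₁, ¬(g • y ∈ Φ i₁ ↔ y ∈ Φ i₁))
    (hirr : ∀ W : Submodule ℚ (E i₁ → ℚ), W ≤ antiSpan G (Φ i₁) → W ≠ ⊥ →
      (∀ (k : G) (f : E i₁ → ℚ), f ∈ W → (fun y => f (k • y)) ∈ W) → W = antiSpan G (Φ i₁)) :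
    typeRank G (sigmaType Φ) + Fintype.card I = (∑ i, typeRank G (Φ i)) + 1 :=
  haveI : Nonempty I := ⟨i₁⟩
  typeRank_sigmaType_add_card_eq_of_forall_map_le h (forall_map_slotExt_le_of_stabSep_pair i₁ hI h01 hg0 hg1 hirr)

/-- **A pair under stabiliser separation is nondegenerate iff both members are** (Moonen–Zarhin's "`X₁ ≁ X₂` ⟹
`Hg(X) = Hg(X₁) × Hg(X₂)`" mechanism for CM surfaces, in Hazama–Murty's rank form).
[cite: MoonenZarhin1999LowDim, "Hodge groups of simple abelian surfaces of CM-type"] -/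
theorem typeRank_sigmaType_eq_iff_forall_of_stabSep_pair (h : ∀ i, IsCMTypeWith ρ (Φ i)) {i₀ : I}
    (hI : ∀ j, j = i₀ ∨ j = i₁) (h01 : i₀ ≠ i₁) (hg0 : ∀ i, i ≠ i₁ → ∀ y : E i, g • y ∈ Φ i ↔ y ∈ Φ i)
    (hg1 : ∃ y : E i₁, ¬(g • y ∈ Φ i₁ ↔ y ∈ Φ i₁))
    (hirr : ∀ W : Submodule ℚ (E i₁ → ℚ), W ≤ antiSpan G (Φ i₁) → W ≠ ⊥ →
      (∀ (k : G) (f : E i₁ → ℚ), f ∈ W → (fun y => f (k • y)) ∈ W) → W = antiSpan G (Φ i₁)) :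
    typeRank G (sigmaType Φ) = Fintype.card (Σ i, E i) / 2 + 1 ↔
      ∀ i, typeRank G (Φ i) = Fintype.card (E i) / 2 + 1 :=
  haveI : Nonempty I := ⟨i₁⟩
  typeRank_sigmaType_eq_iff_forall_of_forall_map_le h (forall_map_slotExt_le_of_stabSep_pair i₁ hI h01 hg0 hg1 hirr)

end StabSep

end Literature.NumberTheory.ComplexMultiplication

end
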